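import Summits.HodgeConjecture.HodgeConjecture.Theorems.TropicalWeilObstructionTropicalWeilVanishingCalibrationTwoSeedChecksA
import Summits.HodgeConjecture.HodgeConjecture.Theorems.TropicalWeilObstructionTropicalWeilVanishingCalibrationTwoSeedDataF

/-!
# Route `TropicalWeilObstruction` (Kontsevich's tropical test — NEGATION SINK, exploration, no summit claim):
# the `n = 2` CALIBRATION seed — KERNEL CHECKS part C2: section 2 of the linearised realisation system

Negation-sink bookkeeping of the cell `pub-hodge-tropical` (seat tropical-2 gen 7). Every identity the tree's certificate format
`TropicalTorusCycle 4 2 Q` asks of the `240`-cell seed of `…CalibrationTwoSeedData{A–G}` (tropicalised van Geemen exceptional cycle on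
the tropical Weil fourfold of period `Q = QZ/2`), and the four integer solutions of its linearised realisation system (p313252), as
closed integer statements proved by `decide +kernel`: edge equations (`vert_id`), positive edge determinants (`det_pos`), saturation
(`leftinv`), the facet identities at period `QZ` (`facet_id`), the slot lists of the facet classes (`slots_mem`, `slots_cls`,
`slots_nodup`), the balancing of every facet class on all Plücker coordinates in reduced form (`balanced_red`), the value
`Σ_σ w_σ det(Tz_σ)((Re η_σ)² − (Im η_σ)²) = reW2 ≠ 0` (`reW2_sum`, `reW2_ne_zero`), and the section identities in the four directions `E2 t`
(`sec_vert`, `sec_facet`). The assembly into a `TropicalTorusCycle`, `W ≠ 0` and the calibration theorem are in `…CalibrationTwo`.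

HONEST STATUS. Kernel re-check of a seat computation (independent replication of ring-2 seat b04 g37's n = 2 calibration); decides
nothing about K1 (`TropicalWeilVanishing`, `n = 4`, OPEN) or about HC. No named fact, no sorry; `decide +kernel` on integer literals only.
References: [Zharkov2020TropicalWeil] I. Zharkov, arXiv:2002.02347, §2 (pp. 2–4); [MikhalkinZharkov2014Eigenwave] G. Mikhalkin,
I. Zharkov, LN UMI 15 (2014), Def. 4.2, Prop. 4.3; B. van Geemen, CIME lecture (LNM 1594, 1994) §7.5.
-/

set_option linter.dupNamespace false

namespace Summit.HodgeConjecture.HodgeConjecture.Theorems.TropicalWeilVanishing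

namespace CalibTwo

open scoped BigOperators

set_option maxRecDepth 100000 in
set_option maxHeartbeats 400000000 in
/-- Section edge equations, direction `2`. [folklore] -/
theorem sec_vert₂ : ∀ (σ : Fin N) (j : Fin 2) (a : Fin 4), SV2 σ j.succ a - SV2 σ 0 a = ∑ m : Fin 2, Fz σ a m * ST2 σ m j := by
  intro σ; fin_cases σ <;> decide +kernel

set_option maxRecDepth 100000 in
set_option maxHeartbeats 400000000 in
/-- Section facet equations, direction `2`. [folklore] -/
theorem sec_facet₂ : ∀ (σ : Fin N) (i : Fin 3) (j : Fin 2) (a : Fin 4),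
    SV2 σ (i.succAbove (prm σ i j)) a = SR2 (cls σ i) j a + ∑ b : Fin 4, E2 2 a b * Sz σ i b := by
  intro σ; fin_cases σ <;> decide +kernel

end CalibTwo

end Summit.HodgeConjecture.HodgeConjecture.Theorems.TropicalWeilVanishing
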